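import Summits.Ventures.PercRepro2.CaseOnePendantTreeMarks
import Summits.Ventures.PercRepro2.CaseOneSeriesProps

/-!
# Thickenings: the four forms for all weights survive leaf attachment, parallel duplication and
series subdivision
(blind cell PercRepro2, p1 g22; the three typed reduction rules of S5 §2.2 read upward)

`FourFormsAll R o a₁ a₂ b E ends v` (CaseOnePendantTreeMarks) says that the statement vertex `v` has
`(ii)`, `(ii-Q)`, `(i)`, `(i-Q)` in `(E, ends)` for every weight vector. The three kernel transfers —
leaf deletion (`CaseOneLeafDelete`), parallel merge (`CaseOneParallelMerge`), series suppression
(`CaseOneSeries`) — read upward say that this property is inherited from the reduced graph by the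
graph it reduces: `fourFormsAll_of_restrict` (a leaf `a₃ ∉ {o, a₁, a₂, v, b}` hanging anywhere),
`fourFormsAll_of_merge` (a parallel copy of any edge), `fourFormsAll_of_series` (an edge `{x, z}`
subdivided by a new vertex `w ∉ {o, a₁, a₂, v, b}`). Together with `fourFormsAll_of_pendantTree_fourFormsAll`
(pendant trees of any shape): the closed set of the rung is closed under every series–parallel
thickening away from the five marked vertices, and under parallel duplication everywhere. The
`fourForms_of_*` lemmas are the same statements for one weight vector. Own code; standard axioms. -/

namespace Summit.Ventures.PercRepro2

namespace CaseOne

universe u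

section Thickening
variable {V : Type*} {R : Type*} [CommRing R] [LinearOrder R] [IsStrictOrderedRing R]
variable {E : Type u} [Fintype E] [DecidableEq E] {ends : E → Sym2 V} {o a₁ a₂ v b : V}

omit [IsStrictOrderedRing R] in
/-- The four forms at `v` in `G − e₀` give the four forms at `v` in `G` when `e₀` carries a leaf
`a₃ ∉ {o, a₁, a₂, v, b}` (leaf deletion read upward). -/
theorem fourForms_of_restrict {u a₃ : V} {e₀ : E} (p : E → R) (hl : IsLeafAt ends u a₃ e₀)
    (ho : o ≠ a₃) (h1 : a₁ ≠ a₃) (h2 : a₂ ≠ a₃) (hv : v ≠ a₃) (hb : b ≠ a₃)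
    (h : FourForms (restrictW p e₀) (restrictEnds ends e₀) o a₁ a₂ v b) :
    FourForms p ends o a₁ a₂ v b :=
  ⟨zSplitII_of_restrict p hl ho h1 h2 hv hb h.1, zSplitIIQ_of_restrict p hl ho h1 h2 hv hb h.2.1,
    zSplitI_of_restrict p hl ho h1 h2 hv hb h.2.2.1, zSplitIQ_of_restrict p hl ho h1 h2 hv hb h.2.2.2⟩

omit [IsStrictOrderedRing R] in
/-- The four forms at `v` in the merged graph give the four forms at `v` in `G` (parallel copies of an
edge, anywhere). -/
theorem fourForms_of_merge {e₀ e₁ : E} (p : E → R) (hpar : ends e₀ = ends e₁) (hne : e₀ ≠ e₁)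
    (h : FourForms (mergeW p e₀ e₁) (restrictEnds ends e₁) o a₁ a₂ v b) :
    FourForms p ends o a₁ a₂ v b :=
  ⟨zSplitII_of_merge p hpar hne h.1, zSplitIIQ_of_merge p hpar hne h.2.1,
    zSplitI_of_merge p hpar hne h.2.2.1, zSplitIQ_of_merge p hpar hne h.2.2.2⟩

omit [IsStrictOrderedRing R] in
/-- The four forms at `v` in the contracted graph give the four forms at `v` in `G` (an edge subdivided
by a vertex `w ∉ {o, a₁, a₂, v, b}`). -/
theorem fourForms_of_series {x w z : V} {e₀ e₁ : E} (p : E → R) (hs : IsSeriesAt ends x w z e₀ e₁)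
    (ho : o ≠ w) (h1 : a₁ ≠ w) (h2 : a₂ ≠ w) (hv : v ≠ w) (hb : b ≠ w)
    (h : FourForms (seriesW p e₀ e₁) (seriesEnds ends e₀ e₁ x z) o a₁ a₂ v b) :
    FourForms p ends o a₁ a₂ v b :=
  ⟨zSplitII_of_series p hs ho h1 h2 hv hb h.1, zSplitIIQ_of_series p hs ho h1 h2 hv hb h.2.1,
    zSplitI_of_series p hs ho h1 h2 hv hb h.2.2.1, zSplitIQ_of_series p hs ho h1 h2 hv hb h.2.2.2⟩

variable (o a₁ a₂ b)

omit [Fintype E] [DecidableEq E] in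
/-- **Leaf attachment preserves the closed property**: if `v` has the four forms for every weight
vector in `G − e₀`, it has them for every weight vector in `G`, for a leaf `a₃ ∉ {o, a₁, a₂, v, b}`
at `e₀`. -/
theorem fourFormsAll_of_restrict {u a₃ : V} {e₀ : E} (hl : IsLeafAt ends u a₃ e₀) (ho : o ≠ a₃)
    (h1 : a₁ ≠ a₃) (h2 : a₂ ≠ a₃) (hv : v ≠ a₃) (hb : b ≠ a₃)
    (h : FourFormsAll R o a₁ a₂ b {e : E // e ≠ e₀} (restrictEnds ends e₀) v) :
    FourFormsAll R o a₁ a₂ b E ends v := by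
  intro _ _ p hp
  exact fourForms_of_restrict p hl ho h1 h2 hv hb (h (restrictW p e₀) (IsProbVec.restrictW hp e₀))

omit [Fintype E] [DecidableEq E] in
/-- **Parallel duplication preserves the closed property**: if `v` has the four forms for every weight
vector in `G − e₁`, it has them for every weight vector in `G`, for `e₁` parallel to `e₀`. -/
theorem fourFormsAll_of_merge {e₀ e₁ : E} (hpar : ends e₀ = ends e₁) (hne : e₀ ≠ e₁)
    (h : FourFormsAll R o a₁ a₂ b {e : E // e ≠ e₁} (restrictEnds ends e₁) v) :
    FourFormsAll R o a₁ a₂ b E ends v := by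
  intro _ _ p hp
  exact fourForms_of_merge p hpar hne (h (mergeW p e₀ e₁) (IsProbVec.mergeW hp e₀ e₁))

omit [Fintype E] in
/-- **Series subdivision preserves the closed property**: if `v` has the four forms for every weight
vector in the graph with `w` contracted away, it has them for every weight vector in `G`, for a series
vertex `w ∉ {o, a₁, a₂, v, b}`. -/
theorem fourFormsAll_of_series {x w z : V} {e₀ e₁ : E} (hs : IsSeriesAt ends x w z e₀ e₁) (ho : o ≠ w)
    (h1 : a₁ ≠ w) (h2 : a₂ ≠ w) (hv : v ≠ w) (hb : b ≠ w)
    (h : FourFormsAll R o a₁ a₂ b {e : E // e ≠ e₁} (seriesEnds ends e₀ e₁ x z) v) :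
    FourFormsAll R o a₁ a₂ b E ends v := by
  intro _ _ p hp
  -- `h` was stated with the outer `DecidableEq E` instance: identify the two (a subsingleton)
  have h' : FourForms (seriesW p e₀ e₁) (seriesEnds ends e₀ e₁ x z) o a₁ a₂ v b := by
    have hh := h (seriesW p e₀ e₁) (IsProbVec.seriesW hp e₀ e₁)
    convert hh using 2
  exact fourForms_of_series p hs ho h1 h2 hv hb h'

end Thickening

end CaseOne

end Summit.Ventures.PercRepro2
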